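import Summits.CriticalPhenomena.PercolationContinuityZ3.Theorems.PercNearOneGluingNoHeavyLowerTailAntitheticApexConeZones
import HarnessLib

/-!
# `NoHeavyLowerTail` (stmt-CriticalPhenomena-4575) — antithetic cluster pairs: the zone system of THEOREM K — part 2: CONSISTENCY
# (zones whose blocks share an edge have the same colour; prim-hp-2 gen 37, MEMO-gen37 §2)

Support file (`--supports stmt-CriticalPhenomena-4575`, hull-port prover `prim-hp-2`, gen 37).  No definitions, no named facts, no sorries;
standard axioms.  Setting and rule: `…AntitheticApexConeZones`.  From this file on the class hypothesis is used only through the KEY PROPERTY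
`hkey`: for every colouring, every vertex reached in neither colour has a monochromatic star (true on cones with clique-apexes by
`ACone.mono_of_unreached`; THEOREM K is proved for every `(E, s)` with the key property).

CONSISTENCY (`ACone.consistent`): in the class "cones with clique-apexes", for `T` in the constraint set and `u, v ∈ R` whose zone blocks
share an edge, `β(u) = β(v)`.  By the LARGE/SMALL dichotomy (`ACone.large_or_small_of_beta`, `…_of_not_beta`) a red zone is the blue cluster of `u` containing a reached `R`-vertex and no
blue-reached vertex (LARGE) or `{u}` with `u` unreached, unswallowed, all `u`-edges red (SMALL); symmetrically for blue zones.  LARGE/LARGE: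
a shared edge without a common vertex is a boundary edge of both zones (red and blue — impossible); a common vertex `z` is unreached, hence
its blue path into the one zone and its red path into the other give `z` a two-coloured star, contradicting the KEY PROPERTY (every
unreached vertex has a monochromatic star — the form in which the class hypothesis enters; `ACone.false_of_common`).  LARGE/SMALL: the
small vertex inside the large zone would be swallowed; outside, the shared edge is a boundary edge of the large zone of the wrong colour.
SMALL/SMALL: the shared edge joins the two vertices and would be red and blue.
[cite: VandenbergHaggstromKahn2005, §1 p. 3 (open cluster `C_s`)]
-/

noncomputable section

namespace Summit.CriticalPhenomena.PercolationContinuityZ3.Theorems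

open Literature.Probability.Percolation
open scoped Classical symmDiff

namespace Antithetic

namespace ACone

section Consistency

variable {V : Type*} {E : Set (Sym2 V)} {s : V} {R : Set V} {T : Set (Sym2 V)} {r : V}

/-- **Boundary property, key form** (`ACone.boundary` with the class hypothesis replaced by the KEY PROPERTY: every vertex reached in
neither colour has a monochromatic star). [this work] -/
theorem boundary_key (hkey : ∀ (T : Set (Sym2 V)) (x : V), ¬ (openGraph (T ∩ E)).Reachable s x → ¬ (openGraph (Tᶜ ∩ E)).Reachable s x →
      (∀ u, s(x, u) ∈ E → u ≠ x → s(x, u) ∈ T) ∨ (∀ u, s(x, u) ∈ E → u ≠ x → s(x, u) ∉ T))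
    (hD : ¬ ((openGraph (T ∩ E)).Reachable s r ∧ (openGraph (Tᶜ ∩ E)).Reachable s r))
    {x y : V} (hx : x ∉ zone E s R T r) (hy : y ∈ zone E s R T r) (hxy : s(x, y) ∈ E) :
    (s(x, y) ∈ T ↔ r ∈ beta E s R T) := by
  by_cases hr : (openGraph (T ∩ E)).Reachable s r
  · rw [zone_of_red hD hr] at hx hy
    have h := not_mem_of_boundary (Tᶜ ∩ E) r hx hy
    exact iff_of_true (by_contra fun h' => h ⟨h', hxy⟩) (beta_of_red hr)
  · by_cases hb : (openGraph (Tᶜ ∩ E)).Reachable s r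
    · rw [zone_of_blue hD hb] at hx hy
      have h := not_mem_of_boundary (T ∩ E) r hx hy
      exact iff_of_false (fun h' => h ⟨h', hxy⟩) (not_beta_of_blue hD hb)
    · rw [beta_iff_of_none hr hb]
      rcases hkey T r hr hb with hm | hm
      · have hred : ∀ u, s(r, u) ∈ E → u ≠ r → r ∈ hasRed E T := fun u hu hur => ⟨u, hu, hur, hm u hu hur⟩
        by_cases hsw : r ∈ sw E s R T
        · rw [zone_of_sw hr hb hsw, big_of_allRed hm] at hx hy
          have h := not_mem_of_boundary (T ∩ E) r hx hy
          obtain ⟨q, -, -, hqb, hqr⟩ := sw_witness hr hb hsw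
          have hred' : r ∈ hasRed E T := by
            rcases edge_of_mem_big hqb hqr with ⟨u, huE, hur, -, -⟩ | ⟨u, huE, hur, -, -⟩
            · exact hred u huE hur
            · exact hred u huE hur
          exact iff_of_false (fun h' => h ⟨h', hxy⟩) fun h' => (h'.1 hsw) hred'
        · rw [zone_of_small hr hb hsw, Set.mem_singleton_iff] at hx hy
          subst hy
          have hyx : s(y, x) ∈ E := by rw [Sym2.eq_swap]; exact hxy
          refine iff_of_true (by rw [Sym2.eq_swap]; exact hm x hyx hx) ?_
          exact (iff_false_left hsw).2 (not_not.2 (hred x hyx hx))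
      · have hnred : r ∉ hasRed E T := fun ⟨u, huE, hur, huT⟩ => hm u huE hur huT
        by_cases hsw : r ∈ sw E s R T
        · rw [zone_of_sw hr hb hsw, big_of_allBlue hm] at hx hy
          have h := not_mem_of_boundary (Tᶜ ∩ E) r hx hy
          exact iff_of_true (by_contra fun h' => h ⟨h', hxy⟩) ((iff_true_left hsw).2 hnred)
        · rw [zone_of_small hr hb hsw, Set.mem_singleton_iff] at hx hy
          subst hy
          have hyx : s(y, x) ∈ E := by rw [Sym2.eq_swap]; exact hxy
          refine iff_of_false (by rw [Sym2.eq_swap]; exact hm x hyx hx) ?_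
          exact fun h' => hsw (h'.2 hnred)

/-- **LARGE / SMALL dichotomy for a red-coloured zone.**  In the class, for `r ∈ R` not doubly reached with `beta r`: either the zone is
the blue cluster of `r`, `r` is not blue-reached and the zone contains a reached vertex of `R` (LARGE), or the zone is `{r}`, `r` is
unreached, not swallowed, and all its edges are red (SMALL). [this work] -/
theorem large_or_small_of_beta (hkey : ∀ (T : Set (Sym2 V)) (x : V), ¬ (openGraph (T ∩ E)).Reachable s x → ¬ (openGraph (Tᶜ ∩ E)).Reachable s x →
      (∀ u, s(x, u) ∈ E → u ≠ x → s(x, u) ∈ T) ∨ (∀ u, s(x, u) ∈ E → u ≠ x → s(x, u) ∉ T))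
    (hrR : r ∈ R) (hD : ¬ ((openGraph (T ∩ E)).Reachable s r ∧ (openGraph (Tᶜ ∩ E)).Reachable s r))
    (hβ : r ∈ beta E s R T) :
    (zone E s R T r = openCluster (Tᶜ ∩ E) r ∧ ¬ (openGraph (Tᶜ ∩ E)).Reachable s r ∧
        ∃ q ∈ R, ((openGraph (T ∩ E)).Reachable s q ∨ (openGraph (Tᶜ ∩ E)).Reachable s q) ∧ q ∈ openCluster (Tᶜ ∩ E) r) ∨
      (zone E s R T r = {r} ∧ ¬ (openGraph (T ∩ E)).Reachable s r ∧ ¬ (openGraph (Tᶜ ∩ E)).Reachable s r ∧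
        r ∉ sw E s R T ∧ ∀ u, s(r, u) ∈ E → u ≠ r → s(r, u) ∈ T) := by
  by_cases hr : (openGraph (T ∩ E)).Reachable s r
  · exact Or.inl ⟨zone_of_red hD hr, fun h => hD ⟨hr, h⟩, r, hrR, Or.inl hr, mem_openCluster_self _ _⟩
  · by_cases hb : (openGraph (Tᶜ ∩ E)).Reachable s r
    · exact absurd hβ (not_beta_of_blue hD hb)
    · rw [beta_iff_of_none hr hb] at hβ
      rcases hkey _ _ hr hb with hm | hm
      · by_cases hsw : r ∈ sw E s R T
        · -- swallowed with red edges: impossible (the swallower lies in the red cluster, so `r` has a red edge)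
          exfalso
          obtain ⟨q, -, -, hqb, hqr⟩ := sw_witness hr hb hsw
          rcases edge_of_mem_big hqb hqr with ⟨u, huE, hur, huT, -⟩ | ⟨u, huE, hur, huT, -⟩
          · exact hβ.1 hsw ⟨u, huE, hur, huT⟩
          · exact huT (hm u huE hur)
        · exact Or.inr ⟨zone_of_small hr hb hsw, hr, hb, hsw, hm⟩
      · by_cases hsw : r ∈ sw E s R T
        · refine Or.inl ⟨(zone_of_sw hr hb hsw).trans (big_of_allBlue hm), hb, ?_⟩
          obtain ⟨q, hqR, hq, hqb, -⟩ := sw_witness hr hb hsw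
          exact ⟨q, hqR, hq, by rwa [big_of_allBlue hm] at hqb⟩
        · exfalso
          have h := hβ
          rw [iff_false_left hsw, not_not] at h
          obtain ⟨u, huE, hur, huT⟩ := h
          exact hm u huE hur huT

/-- A zone whose block contains an edge belongs to a vertex with a non-loop edge. [this work] -/
theorem hasEdge_of_mem_blk (hD : ¬ ((openGraph (T ∩ E)).Reachable s r ∧ (openGraph (Tᶜ ∩ E)).Reachable s r))
    {e : Sym2 V} (he : e ∈ ZoneSys.blk E (zone E s R T r)) : ∃ u, s(r, u) ∈ E ∧ u ≠ r := by
  have hrs := ne_source_of_constraint hD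
  by_cases hr : (openGraph (T ∩ E)).Reachable s r
  · obtain ⟨u, hu, hur⟩ := Apex.exists_adj_of_reachable hrs hr
    exact ⟨u, hu.2, hur⟩
  · by_cases hb : (openGraph (Tᶜ ∩ E)).Reachable s r
    · obtain ⟨u, hu, hur⟩ := Apex.exists_adj_of_reachable hrs hb
      exact ⟨u, hu.2, hur⟩
    · by_cases hsw : r ∈ sw E s R T
      · obtain ⟨q, -, -, hqb, hqr⟩ := sw_witness hr hb hsw
        rcases edge_of_mem_big hqb hqr with ⟨u, huE, hur, -, -⟩ | ⟨u, huE, hur, -, -⟩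
        · exact ⟨u, huE, hur⟩
        · exact ⟨u, huE, hur⟩
      · rw [zone_of_small hr hb hsw] at he
        obtain ⟨heE, hnd, x, hx, hxe⟩ := he
        rw [Set.mem_singleton_iff] at hx
        rw [hx] at hxe
        refine ⟨Sym2.Mem.other hxe, ?_, Sym2.other_ne hnd hxe⟩
        rw [Sym2.other_spec hxe]
        exact heE

/-- **LARGE / SMALL dichotomy for a blue-coloured zone** (mirror image of `large_or_small_of_beta`, via the colour swap). [this work] -/
theorem large_or_small_of_not_beta (hkey : ∀ (T : Set (Sym2 V)) (x : V), ¬ (openGraph (T ∩ E)).Reachable s x → ¬ (openGraph (Tᶜ ∩ E)).Reachable s x →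
      (∀ u, s(x, u) ∈ E → u ≠ x → s(x, u) ∈ T) ∨ (∀ u, s(x, u) ∈ E → u ≠ x → s(x, u) ∉ T))
    (hrR : r ∈ R) (hD : ¬ ((openGraph (T ∩ E)).Reachable s r ∧ (openGraph (Tᶜ ∩ E)).Reachable s r))
    (hedge : ∃ u, s(r, u) ∈ E ∧ u ≠ r) (hβ : r ∉ beta E s R T) :
    (zone E s R T r = openCluster (T ∩ E) r ∧ ¬ (openGraph (T ∩ E)).Reachable s r ∧
        ∃ q ∈ R, ((openGraph (T ∩ E)).Reachable s q ∨ (openGraph (Tᶜ ∩ E)).Reachable s q) ∧ q ∈ openCluster (T ∩ E) r) ∨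
      (zone E s R T r = {r} ∧ ¬ (openGraph (T ∩ E)).Reachable s r ∧ ¬ (openGraph (Tᶜ ∩ E)).Reachable s r ∧
        r ∉ sw E s R T ∧ ∀ u, s(r, u) ∈ E → u ≠ r → s(r, u) ∉ T) := by
  have hD' : ¬ ((openGraph (Tᶜ ∩ E)).Reachable s r ∧ (openGraph (Tᶜᶜ ∩ E)).Reachable s r) := by
    rw [compl_compl]; exact fun h => hD ⟨h.2, h.1⟩
  have hβ' : r ∈ beta E s R Tᶜ := (beta_compl hD (hkey _ _) hedge).2 hβ
  rcases large_or_small_of_beta hkey hrR hD' hβ' with ⟨hZ, hb, q, hqR, hq, hqm⟩ | ⟨hZ, hr, hb, hsw, hm⟩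
  · rw [zone_compl, compl_compl] at hZ
    rw [compl_compl] at hb hq hqm
    exact Or.inl ⟨hZ, hb, q, hqR, hq.symm, hqm⟩
  · rw [zone_compl] at hZ
    rw [compl_compl] at hb
    rw [sw_compl] at hsw
    exact Or.inr ⟨hZ, hb, hr, hsw, fun u hu hur => hm u hu hur⟩

/-- **No common vertex.**  Under the key property, a blue cluster containing a reached vertex and no blue-reached vertex and a red
cluster containing a reached vertex and no red-reached vertex are disjoint. [this work] -/
theorem false_of_common (hkey : ∀ (T : Set (Sym2 V)) (x : V), ¬ (openGraph (T ∩ E)).Reachable s x → ¬ (openGraph (Tᶜ ∩ E)).Reachable s x →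
      (∀ u, s(x, u) ∈ E → u ≠ x → s(x, u) ∈ T) ∨ (∀ u, s(x, u) ∈ E → u ≠ x → s(x, u) ∉ T))
    {u v z : V} (hnbu : ¬ (openGraph (Tᶜ ∩ E)).Reachable s u) (hnrv : ¬ (openGraph (T ∩ E)).Reachable s v)
    (hqu : ∃ q, ((openGraph (T ∩ E)).Reachable s q ∨ (openGraph (Tᶜ ∩ E)).Reachable s q) ∧ q ∈ openCluster (Tᶜ ∩ E) u)
    (hqv : ∃ q, ((openGraph (T ∩ E)).Reachable s q ∨ (openGraph (Tᶜ ∩ E)).Reachable s q) ∧ q ∈ openCluster (T ∩ E) v)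
    (hzu : z ∈ openCluster (Tᶜ ∩ E) u) (hzv : z ∈ openCluster (T ∩ E) v) : False := by
  have hzb : ¬ (openGraph (Tᶜ ∩ E)).Reachable s z := not_reachable_of_mem_openCluster _ hzu hnbu
  have hzr : ¬ (openGraph (T ∩ E)).Reachable s z := not_reachable_of_mem_openCluster _ hzv hnrv
  -- a blue edge `z w` inside the blue cluster of `u`
  obtain ⟨qu, hqur, hqum⟩ := hqu
  have hzqu : z ≠ qu := by
    rintro rfl
    exact hqur.elim hzr hzb
  have hz₁ : z ∈ openCluster (Tᶜ ∩ E) qu := by rw [openCluster_eq_of_mem _ hqum]; exact hzu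
  obtain ⟨w, hw, hwz, -⟩ := exists_adj_of_mem_openCluster _ hz₁ hzqu
  -- a red edge `z w'` inside the red cluster of `v`
  obtain ⟨qv, hqvr, hqvm⟩ := hqv
  have hzqv : z ≠ qv := by
    rintro rfl
    exact hqvr.elim hzr hzb
  have hz₂ : z ∈ openCluster (T ∩ E) qv := by rw [openCluster_eq_of_mem _ hqvm]; exact hzv
  obtain ⟨w', hw', hw'z, -⟩ := exists_adj_of_mem_openCluster _ hz₂ hzqv
  -- `z` is unreached with a blue and a red edge: its star is not monochromatic
  rcases hkey T z hzr hzb with hm | hm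
  · exact hw.1 (hm w hw.2 hwz)
  · exact hm w' hw'.2 hw'z hw'.1

/-- Two members of a non-loop pair that differ determine it. [folklore] -/
theorem eq_mk_of_mem_mem {e : Sym2 V} {a c : V} (ha : a ∈ e) (hc : c ∈ e) (hac : a ≠ c) : e = s(a, c) :=
  (Sym2.mem_and_mem_iff hac).1 ⟨ha, hc⟩

/-- **Asymmetric consistency**: a red zone and a blue zone of `R`-vertices have edge-disjoint blocks. [this work] -/
theorem false_of_beta_of_not_beta (hkey : ∀ (T : Set (Sym2 V)) (x : V), ¬ (openGraph (T ∩ E)).Reachable s x → ¬ (openGraph (Tᶜ ∩ E)).Reachable s x →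
      (∀ u, s(x, u) ∈ E → u ≠ x → s(x, u) ∈ T) ∨ (∀ u, s(x, u) ∈ E → u ≠ x → s(x, u) ∉ T))
    (hT : ∀ r ∈ R, ¬ ((openGraph (T ∩ E)).Reachable s r ∧ (openGraph (Tᶜ ∩ E)).Reachable s r))
    {u v : V} (hu : u ∈ R) (hv : v ∈ R) {e : Sym2 V}
    (heu : e ∈ ZoneSys.blk E (zone E s R T u)) (hev : e ∈ ZoneSys.blk E (zone E s R T v))
    (hbu : u ∈ beta E s R T) (hbv : v ∉ beta E s R T) : False := by
  have hedge := hasEdge_of_mem_blk (hT v hv) hev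
  obtain ⟨heE, -, a, hau, hae⟩ := heu
  obtain ⟨-, -, c, hcv, hce⟩ := hev
  rcases large_or_small_of_beta hkey hu (hT u hu) hbu with ⟨hZu, hnbu, qu, hquR, hqu, hqum⟩ | ⟨hZu, hru, hbu', hswu, hmu⟩
  · rw [hZu] at hau
    rcases large_or_small_of_not_beta hkey hv (hT v hv) hedge hbv with
        ⟨hZv, hnrv, qv, -, hqv, hqvm⟩ | ⟨hZv, -, -, hswv, hmv⟩
    · -- LARGE / LARGE
      rw [hZv] at hcv
      by_cases hc : c ∈ openCluster (Tᶜ ∩ E) u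
      · exact false_of_common hkey hnbu hnrv ⟨qu, hqu, hqum⟩ ⟨qv, hqv, hqvm⟩ hc hcv
      · by_cases ha : a ∈ openCluster (T ∩ E) v
        · exact false_of_common hkey hnbu hnrv ⟨qu, hqu, hqum⟩ ⟨qv, hqv, hqvm⟩ hau ha
        · have hac : a ≠ c := by
            rintro rfl
            exact hc hau
          rw [eq_mk_of_mem_mem hae hce hac] at heE
          have h1 := not_mem_of_boundary (Tᶜ ∩ E) u hc hau   -- `s(c, a)` is red
          have h2 := not_mem_of_boundary (T ∩ E) v ha hcv    -- `s(a, c)` is blue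
          have hca : s(c, a) ∈ E := by rw [Sym2.eq_swap]; exact heE
          have hred : s(c, a) ∈ T := by
            by_contra h
            exact h1 ⟨h, hca⟩
          exact h2 ⟨by rw [Sym2.eq_swap]; exact hred, heE⟩
    · -- LARGE / SMALL
      rw [hZv, Set.mem_singleton_iff] at hcv
      subst hcv
      by_cases hvu : c ∈ openCluster (Tᶜ ∩ E) u
      · exact hswv ⟨qu, hquR, hqu, Or.inr (by rw [openCluster_eq_of_mem _ hvu]; exact hqum)⟩
      · have hac : a ≠ c := by
          rintro rfl
          exact hvu hau
        rw [eq_mk_of_mem_mem hae hce hac] at heE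
        have hca : s(c, a) ∈ E := by rw [Sym2.eq_swap]; exact heE
        have h1 := not_mem_of_boundary (Tᶜ ∩ E) u hvu hau
        have hred : s(c, a) ∈ T := by
          by_contra h
          exact h1 ⟨h, hca⟩
        exact hmv a hca hac hred
  · rw [hZu, Set.mem_singleton_iff] at hau
    subst hau
    rcases large_or_small_of_not_beta hkey hv (hT v hv) hedge hbv with
        ⟨hZv, hnrv, qv, hqvR, hqv, hqvm⟩ | ⟨hZv, -, -, -, hmv⟩
    · -- SMALL / LARGE
      rw [hZv] at hcv
      by_cases huv : a ∈ openCluster (T ∩ E) v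
      · exact hswu ⟨qv, hqvR, hqv, Or.inl (by rw [openCluster_eq_of_mem _ huv]; exact hqvm)⟩
      · have hac : a ≠ c := by
          rintro rfl
          exact huv hcv
        rw [eq_mk_of_mem_mem hae hce hac] at heE
        have h2 := not_mem_of_boundary (T ∩ E) v huv hcv
        exact h2 ⟨hmu c heE hac.symm, heE⟩
    · -- SMALL / SMALL
      rw [hZv, Set.mem_singleton_iff] at hcv
      subst hcv
      have hac : a ≠ c := by
        rintro rfl
        exact hbv hbu
      rw [eq_mk_of_mem_mem hae hce hac] at heE
      have hca : s(c, a) ∈ E := by rw [Sym2.eq_swap]; exact heE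
      exact hmv a hca hac (by rw [Sym2.eq_swap]; exact hmu c heE hac.symm)

/-- **Consistency of the zone system** (hypothesis (consistency) of `zoneSystem_bic_nonneg`): in the class, two zones of `R`-vertices
whose blocks share an edge have the same colour. [this work] -/
theorem consistent (hkey : ∀ (T : Set (Sym2 V)) (x : V), ¬ (openGraph (T ∩ E)).Reachable s x → ¬ (openGraph (Tᶜ ∩ E)).Reachable s x →
      (∀ u, s(x, u) ∈ E → u ≠ x → s(x, u) ∈ T) ∨ (∀ u, s(x, u) ∈ E → u ≠ x → s(x, u) ∉ T))
    (hT : ∀ r ∈ R, ¬ ((openGraph (T ∩ E)).Reachable s r ∧ (openGraph (Tᶜ ∩ E)).Reachable s r))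
    {u v : V} (hu : u ∈ R) (hv : v ∈ R) {e : Sym2 V}
    (heu : e ∈ ZoneSys.blk E (zone E s R T u)) (hev : e ∈ ZoneSys.blk E (zone E s R T v)) :
    (u ∈ beta E s R T ↔ v ∈ beta E s R T) := by
  by_cases hbu : u ∈ beta E s R T
  · by_cases hbv : v ∈ beta E s R T
    · exact iff_of_true hbu hbv
    · exact (false_of_beta_of_not_beta hkey hT hu hv heu hev hbu hbv).elim
  · by_cases hbv : v ∈ beta E s R T
    · exact (false_of_beta_of_not_beta hkey hT hv hu hev heu hbv hbu).elim
    · exact iff_of_false hbu hbv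

end Consistency

end ACone

end Antithetic

end Summit.CriticalPhenomena.PercolationContinuityZ3.Theorems
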